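import Summits.KontsevichZagierPeriods.KontsevichZagierPeriods.Theorems.ReducedPeriodRing.Negative.OrderTrichotomy

/-!
# `ReducedPeriodRing` (stmt-KontsevichZagierPeriods-3929) — `eval` is the only positive invariant

Negative knowledge for the crux (the POSITIVE-FUNCTIONAL lens is closed; companion of
`Negative/Certificates.lean` and of the volume-dominated case). Call an additive functional
`Λ : KZ.FormalRep →+ ℝ` *positive* if `Λ [σ, f] ≥ 0` for every representation with `f ≥ 0` on `σ`.
The rules of the Kontsevich–Zagier calculus already force a Haar/Riesz-type UNIQUENESS: every
positive functional killing `KZ.relations` is a non-negative real multiple of the evaluation,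

* `nonneg_of_eval_pos` — a positive move-invariant `Λ` is `≥ 0` on every class of positive value
  (such a class is a body modulo the moves, `exists_body_of_eval_pos`, Viu-Sos normal form);
* `abs_le_of_eval_eq_zero`, `positive_invariant_eq_zero_of_eval_eq_zero` — hence
  `|Λ d| ≤ Λ e` whenever `eval d = 0 < eval e`, and testing against the constants `[pt, 1/n]`
  (`Λ [pt, 1/n] ≤ 2 Λ [pt, 1] / n`) gives `Λ = 0` on `ker eval`;
* `invariant_apply_of_eval_eq_ratCast_of_ker`, `positive_invariant_eq_mul_eval`,
  `positive_invariant_eq_eval` — and `Λ c = eval c · Λ u` for any `u` of value `1` (rational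
  calibration through `ker eval`, then a two-sided rational squeeze by monotonicity); normalised by
  `Λ u = 1`, `Λ` IS `eval`;
* `positive_certificate_vanishes`, `certificate_neg_on_body`, `certificate_changes_sign_on_bodies`
  — so a positive move-invariant functional vanishes on every square-zero candidate, and ANY
  additive certificate `φ` against the crux (or against Conjecture 1: `φ` kills the relations but
  not `ker eval`) takes a NEGATIVE value on some compact `ℚ`-semialgebraic body `[K, 1]` and a
  positive value on another: no certificate is a "volume".

No domination or continuity is assumed here (positive non-Lebesgue weights, unbounded near
boundaries or at infinity, are covered); conversely `eval` is positive, so the statement is sharp.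
Lead c9, `--supports stmt-KontsevichZagierPeriods-3929`; no definitions, no named facts.
[Kontsevich–Zagier 2001, §1.2; Viu-Sos, IJNT 17 (2021), Thm. 1.1]
-/

noncomputable section

namespace Summit.KontsevichZagierPeriods.KontsevichZagierPeriods.ReducedPeriodRingNegative

open MeasureTheory Set
open Literature.NumberTheory.Transcendental KZ
open Summit.KontsevichZagierPeriods.KontsevichZagierPeriods.Theses.FurushoPentagon

/-! ### Positivity gives monotonicity along `eval` -/

/-- **A positive move-invariant functional is non-negative on classes of positive value**: such a
class is, modulo the moves, a body `[K, 1]` (`exists_body_of_eval_pos`), on which `Λ ≥ 0`.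
[Viu-Sos, IJNT 17 (2021), Thm. 1.1] -/
theorem nonneg_of_eval_pos {Λ : FormalRep →+ ℝ} (hΛ : ∀ c ∈ relations, Λ c = 0)
    (hpos : ∀ (n : ℕ) (r : IntegralRep n), (∀ y ∈ r.domain, 0 ≤ r.integrand y) → 0 ≤ Λ (of r))
    {d : FormalRep} (hd : 0 < eval d) : 0 ≤ Λ d := by
  obtain ⟨m, K, -, -, hK1, hK⟩ := exists_body_of_eval_pos hd
  have h1 : Λ (d - of K) = 0 := hΛ _ hK
  rw [map_sub, sub_eq_zero] at h1
  rw [h1]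
  exact hpos m K fun z hz => by rw [hK1 z hz]; exact zero_le_one

/-- **`|Λ d| ≤ Λ e` whenever `eval d = 0 < eval e`** (apply `nonneg_of_eval_pos` to `e ± d`).
[folklore] -/
theorem abs_le_of_eval_eq_zero {Λ : FormalRep →+ ℝ} (hΛ : ∀ c ∈ relations, Λ c = 0)
    (hpos : ∀ (n : ℕ) (r : IntegralRep n), (∀ y ∈ r.domain, 0 ≤ r.integrand y) → 0 ≤ Λ (of r))
    {d e : FormalRep} (hd : eval d = 0) (he : 0 < eval e) : |Λ d| ≤ Λ e := by
  have h1 : 0 ≤ Λ (e - d) := nonneg_of_eval_pos hΛ hpos (by rw [map_sub, hd, sub_zero]; exact he)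
  have h2 : 0 ≤ Λ (e + d) := nonneg_of_eval_pos hΛ hpos (by rw [map_add, hd, add_zero]; exact he)
  rw [map_sub] at h1
  rw [map_add] at h2
  rw [abs_le]
  constructor <;> linarith

/-- **A positive move-invariant functional vanishes on `ker eval`.** Test against the constants:
with `u = [pt, 1]` and `rₙ = [pt, 1/n]`, `u − n • rₙ ∈ ker eval` gives `n Λ rₙ ≤ 2 Λ u`
(`abs_le_of_eval_eq_zero` against `u`), and `|Λ d| ≤ Λ rₙ ≤ 2 Λ u / n` for every `n ≥ 1`.
[folklore] -/
theorem positive_invariant_eq_zero_of_eval_eq_zero {Λ : FormalRep →+ ℝ}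
    (hΛ : ∀ c ∈ relations, Λ c = 0)
    (hpos : ∀ (n : ℕ) (r : IntegralRep n), (∀ y ∈ r.domain, 0 ≤ r.integrand y) → 0 ≤ Λ (of r))
    {d : FormalRep} (hd : eval d = 0) : Λ d = 0 := by
  obtain ⟨u, hu⟩ := exists_eval_of_eq_ratCast 1
  have hu1 : eval (of u) = 1 := by rw [hu, Rat.cast_one]
  have hu0 : 0 ≤ Λ (of u) := nonneg_of_eval_pos hΛ hpos (by rw [hu1]; exact one_pos)
  -- `|Λ d| ≤ 2 Λ u / n` for every `n ≥ 1`
  have key : ∀ n : ℕ, 0 < n → (n : ℝ) * |Λ d| ≤ 2 * Λ (of u) := by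
    intro n hn
    obtain ⟨r, hr⟩ := exists_eval_of_eq_ratCast (1 / n : ℚ)
    have hn' : (0 : ℝ) < n := by exact_mod_cast hn
    have hrv : eval (of r) = 1 / (n : ℝ) := by rw [hr]; push_cast; ring
    have hr0 : 0 < eval (of r) := by rw [hrv]; positivity
    -- `u − n • r ∈ ker eval`, so `|Λ u − n Λ r| ≤ Λ u`
    have hk : eval (of u - (n : ℤ) • of r) = 0 := by
      rw [map_sub, map_zsmul, hu1, hrv, zsmul_eq_mul]
      push_cast
      field_simp
      ring
    have h1 : |Λ (of u - (n : ℤ) • of r)| ≤ Λ (of u) :=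
      abs_le_of_eval_eq_zero hΛ hpos hk (by rw [hu1]; exact one_pos)
    rw [map_sub, map_zsmul, zsmul_eq_mul, Int.cast_natCast, abs_le] at h1
    have h2 : (n : ℝ) * Λ (of r) ≤ 2 * Λ (of u) := by linarith [h1.1]
    -- `|Λ d| ≤ Λ r`
    have h3 : |Λ d| ≤ Λ (of r) := abs_le_of_eval_eq_zero hΛ hpos hd hr0
    calc (n : ℝ) * |Λ d| ≤ (n : ℝ) * Λ (of r) := mul_le_mul_of_nonneg_left h3 hn'.le
      _ ≤ 2 * Λ (of u) := h2
  by_contra hne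
  have hδ : 0 < |Λ d| := abs_pos.mpr hne
  obtain ⟨n, hn⟩ := exists_nat_gt (2 * Λ (of u) / |Λ d|)
  have hn0 : 0 < n := by
    rcases Nat.eq_zero_or_pos n with h | h
    · rw [h, Nat.cast_zero] at hn
      have : 0 ≤ 2 * Λ (of u) / |Λ d| := by positivity
      linarith
    · exact h
  have h1 := key n hn0
  have h2 : 2 * Λ (of u) < (n : ℝ) * |Λ d| := (div_lt_iff₀ hδ).mp hn
  linarith

/-- **Positive certificates vanish on every candidate**: `c * c ∈ relations` forces `eval c = 0`,
so every positive move-invariant functional kills `c`. Companion of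
`multiplicative_certificate_vanishes`, `bounded_exponent_certificate_vanishes`
(`Negative/Certificates.lean`). [folklore] -/
theorem positive_certificate_vanishes {Λ : FormalRep →+ ℝ} (hΛ : ∀ c ∈ relations, Λ c = 0)
    (hpos : ∀ (n : ℕ) (r : IntegralRep n), (∀ y ∈ r.domain, 0 ≤ r.integrand y) → 0 ≤ Λ (of r))
    {c : FormalRep} (hc : c * c ∈ relations) : Λ c = 0 := by
  refine positive_invariant_eq_zero_of_eval_eq_zero hΛ hpos ?_
  have h0 : eval (c * c) = 0 := relations_le_ker_eval_holds hc
  rw [eval_mul'] at h0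
  exact mul_self_eq_zero.mp h0

/-! ### A positive invariant is `eval(·) · Λ u` -/

/-- **Rational calibration through `ker eval`.** If an additive `Λ` vanishes on `ker eval`, a class
of rational value `q` takes the value `q · Λ u` for any `u` of value `1`
(`den(q) • d − num(q) • u ∈ ker eval`). [folklore] -/
theorem invariant_apply_of_eval_eq_ratCast_of_ker {Λ : FormalRep →+ ℝ}
    (hker : ∀ c : FormalRep, eval c = 0 → Λ c = 0)
    {u : FormalRep} (hu : eval u = 1) {d : FormalRep} {q : ℚ} (hd : eval d = q) :
    Λ d = (q : ℝ) * Λ u := by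
  have hqr : (q : ℝ) * (q.den : ℝ) = (q.num : ℝ) := by exact_mod_cast Rat.mul_den_eq_num q
  have hx : eval ((q.den : ℤ) • d - q.num • u) = 0 := by
    rw [map_sub, map_zsmul, map_zsmul, hd, hu, zsmul_eq_mul, zsmul_eq_mul, mul_one, sub_eq_zero,
      mul_comm]
    exact_mod_cast hqr
  have h0 := hker _ hx
  rw [map_sub, map_zsmul, map_zsmul, sub_eq_zero, zsmul_eq_mul, zsmul_eq_mul, Int.cast_natCast] at h0
  have hden : (q.den : ℝ) ≠ 0 := Nat.cast_ne_zero.mpr q.den_nz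
  calc Λ d = (q.den : ℝ)⁻¹ * ((q.den : ℝ) * Λ d) := by rw [← mul_assoc, inv_mul_cancel₀ hden, one_mul]
    _ = (q.den : ℝ)⁻¹ * ((q.num : ℝ) * Λ u) := by rw [h0]
    _ = (q : ℝ) * Λ u := by rw [← mul_assoc, Rat.cast_def, div_eq_inv_mul]

/-- **`eval` is the only positive invariant, up to a non-negative constant.** If
`Λ : FormalRep →+ ℝ` kills `KZ.relations` and is `≥ 0` on representations with non-negative
integrand, then `Λ c = eval c · Λ u` for every `c` and every `u` of value `1` (two-sided rational
squeeze: `q < eval c < q'` gives `q Λ u ≤ Λ c ≤ q' Λ u` by `nonneg_of_eval_pos`).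
[Viu-Sos, IJNT 17 (2021), Thm. 1.1] -/
theorem positive_invariant_eq_mul_eval {Λ : FormalRep →+ ℝ} (hΛ : ∀ c ∈ relations, Λ c = 0)
    (hpos : ∀ (n : ℕ) (r : IntegralRep n), (∀ y ∈ r.domain, 0 ≤ r.integrand y) → 0 ≤ Λ (of r))
    {u : FormalRep} (hu : eval u = 1) (c : FormalRep) : Λ c = eval c * Λ u := by
  have hker : ∀ c : FormalRep, eval c = 0 → Λ c = 0 :=
    fun c hc => positive_invariant_eq_zero_of_eval_eq_zero hΛ hpos hc
  have hu0 : 0 ≤ Λ u := nonneg_of_eval_pos hΛ hpos (by rw [hu]; exact one_pos)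
  set t : ℝ := eval c with ht
  -- lower and upper rational bounds
  have lower : ∀ q : ℚ, (q : ℝ) < t → (q : ℝ) * Λ u ≤ Λ c := by
    intro q hq
    obtain ⟨r, hr⟩ := exists_eval_of_eq_ratCast q
    have h1 : 0 ≤ Λ (c - of r) := nonneg_of_eval_pos hΛ hpos (by rw [map_sub, hr, ← ht]; linarith)
    rw [map_sub, invariant_apply_of_eval_eq_ratCast_of_ker hker hu hr] at h1
    linarith
  have upper : ∀ q : ℚ, t < (q : ℝ) → Λ c ≤ (q : ℝ) * Λ u := by
    intro q hq
    obtain ⟨r, hr⟩ := exists_eval_of_eq_ratCast q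
    have h1 : 0 ≤ Λ (of r - c) := nonneg_of_eval_pos hΛ hpos (by rw [map_sub, hr, ← ht]; linarith)
    rw [map_sub, invariant_apply_of_eval_eq_ratCast_of_ker hker hu hr] at h1
    linarith
  -- `|Λ c − t Λ u| ≤ ε Λ u` for every `ε > 0`
  have bound : ∀ ε : ℝ, 0 < ε → |Λ c - t * Λ u| ≤ ε * Λ u := by
    intro ε hε
    obtain ⟨q, hq1, hq2⟩ := exists_rat_btwn (sub_lt_self t hε)
    obtain ⟨q', hq1', hq2'⟩ := exists_rat_btwn (lt_add_of_pos_right t hε)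
    have h1 := lower q hq2
    have h2 := upper q' hq1'
    have h3 : (t - ε) * Λ u ≤ (q : ℝ) * Λ u := mul_le_mul_of_nonneg_right hq1.le hu0
    have h4 : (q' : ℝ) * Λ u ≤ (t + ε) * Λ u := mul_le_mul_of_nonneg_right hq2'.le hu0
    rw [abs_le]
    constructor <;> nlinarith
  by_contra hne
  have hδ : 0 < |Λ c - t * Λ u| := abs_pos.mpr (sub_ne_zero.mpr hne)
  have h1 := bound (|Λ c - t * Λ u| / (Λ u + 1)) (div_pos hδ (by linarith))
  have h2 : |Λ c - t * Λ u| / (Λ u + 1) * Λ u < |Λ c - t * Λ u| := by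
    rw [div_mul_eq_mul_div, div_lt_iff₀ (by linarith : (0 : ℝ) < Λ u + 1)]
    nlinarith
  linarith

/-- **Uniqueness of the period functional among positive functionals.** A positive move-invariant
additive functional `FormalRep →+ ℝ` normalised by `Λ u = 1` on one class `u` of value `1` IS the
evaluation map. [Viu-Sos, IJNT 17 (2021), Thm. 1.1] -/
theorem positive_invariant_eq_eval {Λ : FormalRep →+ ℝ} (hΛ : ∀ c ∈ relations, Λ c = 0)
    (hpos : ∀ (n : ℕ) (r : IntegralRep n), (∀ y ∈ r.domain, 0 ≤ r.integrand y) → 0 ≤ Λ (of r))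
    {u : FormalRep} (hu : eval u = 1) (hΛu : Λ u = 1) : Λ = eval := by
  refine AddMonoidHom.ext fun c => ?_
  rw [positive_invariant_eq_mul_eval hΛ hpos hu c, hΛu, mul_one]

/-! ### Certificates are never volumes -/

/-- **Every certificate is negative on some body.** If an additive `φ` kills the relations but
`φ c ≠ 0` for some `c` of value `0` (a certificate against Conjecture 1; in particular one against
the crux, `c * c ∈ relations`), then `φ [K, 1] < 0` for some compact `ℚ`-semialgebraic body `K`
with non-empty interior. [folklore] -/
theorem certificate_neg_on_body {φ : FormalRep →+ ℝ} (hφ : ∀ c ∈ relations, φ c = 0)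
    {c : FormalRep} (hc : eval c = 0) (hne : φ c ≠ 0) :
    ∃ (m : ℕ) (K : IntegralRep m), IsCompact K.domain ∧ (interior K.domain).Nonempty ∧
      (∀ z ∈ K.domain, K.integrand z = 1) ∧ φ (of K) < 0 := by
  by_contra h
  push Not at h
  -- then `φ` is positive: a non-negative representation of value `0` is a relation, one of
  -- positive value is a body modulo the moves
  have hpos : ∀ (n : ℕ) (r : IntegralRep n), (∀ y ∈ r.domain, 0 ≤ r.integrand y) → 0 ≤ φ (of r) := by
    intro n r hr
    rcases (eval_nonneg_of_mem_cone (of_mem_cone r hr)).lt_or_eq with hlt | heq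
    · obtain ⟨m, K, hKc, hKi, hK1, hK⟩ := exists_body_of_eval_pos hlt
      have h1 : φ (of r - of K) = 0 := hφ _ hK
      rw [map_sub, sub_eq_zero] at h1
      rw [h1]
      exact h m K hKc hKi hK1
    · rw [hφ _ (mem_relations_of_mem_cone_of_eval_eq_zero (of_mem_cone r hr) heq.symm)]
  exact hne (positive_invariant_eq_zero_of_eval_eq_zero hφ hpos hc)

/-- **Every certificate changes sign on bodies**: with `certificate_neg_on_body` applied to `φ` and
to `−φ`, a certificate against Conjecture 1 (a fortiori against the crux) is negative on one compact
body and positive on another. [folklore] -/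
theorem certificate_changes_sign_on_bodies {φ : FormalRep →+ ℝ} (hφ : ∀ c ∈ relations, φ c = 0)
    {c : FormalRep} (hc : eval c = 0) (hne : φ c ≠ 0) :
    (∃ (m : ℕ) (K : IntegralRep m), IsCompact K.domain ∧ (interior K.domain).Nonempty ∧
      (∀ z ∈ K.domain, K.integrand z = 1) ∧ φ (of K) < 0) ∧
    (∃ (m : ℕ) (K : IntegralRep m), IsCompact K.domain ∧ (interior K.domain).Nonempty ∧
      (∀ z ∈ K.domain, K.integrand z = 1) ∧ 0 < φ (of K)) := by
  refine ⟨certificate_neg_on_body hφ hc hne, ?_⟩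
  obtain ⟨m, K, hKc, hKi, hK1, hK⟩ :=
    certificate_neg_on_body (φ := -φ) (fun d hd => by rw [AddMonoidHom.neg_apply, hφ d hd, neg_zero])
      hc (by rw [AddMonoidHom.neg_apply]; exact neg_ne_zero.mpr hne)
  exact ⟨m, K, hKc, hKi, hK1, by rwa [AddMonoidHom.neg_apply, neg_lt_zero] at hK⟩

/-- **The crux in the certificate language, sharpened.** A real additive certificate against
`ReducedPeriodRing` (`φ` kills the relations, `φ c ≠ 0`, `c * c ∈ relations`) is negative on
some compact body and positive on another. [folklore] -/
theorem crux_certificate_changes_sign_on_bodies {φ : FormalRep →+ ℝ}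
    (hφ : ∀ c ∈ relations, φ c = 0) {c : FormalRep} (hc : c * c ∈ relations) (hne : φ c ≠ 0) :
    (∃ (m : ℕ) (K : IntegralRep m), IsCompact K.domain ∧ (interior K.domain).Nonempty ∧
      (∀ z ∈ K.domain, K.integrand z = 1) ∧ φ (of K) < 0) ∧
    (∃ (m : ℕ) (K : IntegralRep m), IsCompact K.domain ∧ (interior K.domain).Nonempty ∧
      (∀ z ∈ K.domain, K.integrand z = 1) ∧ 0 < φ (of K)) := by
  refine certificate_changes_sign_on_bodies hφ ?_ hne
  have h0 : eval (c * c) = 0 := relations_le_ker_eval_holds hc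
  rw [eval_mul'] at h0
  exact mul_self_eq_zero.mp h0

end Summit.KontsevichZagierPeriods.KontsevichZagierPeriods.ReducedPeriodRingNegative
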